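import Mathlib
import Summits.PneNP.PneNP.Theorems.ConvexRankGatesConvexGateBlindAffinePencilSixValid
import Summits.PneNP.PneNP.Theorems.ConvexRankGatesConvexGateBlindAffinePencilArrow

/-!
# PneNP / ConvexRankGates — `ConvexGateBlind`: ONE valid 6 × 6 pencil excludes all `C(m−k+2, 2)` cliques through a `(k−2)`-set

Helpers (`--supports stmt-PneNP-10680`), COLUMN-SPACE line (prover seat 2, session 26), PSD side; third and last file of
PROPOSITION L (memo ANALYSIS-seat2-s26 §2.3). With the data of `…SixData.lean` and the validity of `…SixValid.lean`:

* `six_pencil_excludes` — at the bare clique `S ∪ {a,b}` (`a ≠ b` outside `S`) the SOC data leave the Lorentz cone: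
  `a = L + κη_r` while `⟨b, nvec r⟩ ≥ L + 2η_r` for the rim `r = {a,b}` (all `2(k−2)` spokes present, each seen at height
  `η_r/(k−2)`), and `κ < 2`;
* `six_pencil_exclusion_number` (registered) — **for `3 ≤ k` and every `(k−2)`-set `S ⊆ [m]` there is an affine `6 × 6`
  pencil `H(x) = H₀ − Σ_e x_e H_e` (arrow matrices = one second-order-cone constraint in `ℝ × ℝ⁵`) that is positive
  semidefinite on every `k`-clique-free graph and NOT positive semidefinite at the bare clique `1_{E(Q)}` of every `k`-set
  `Q ⊇ S`; in particular its exclusion number is at least `C(m − (k−2), 2)`.**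

So the pencil exclusion number satisfies `c(6; m, k) ≥ C(m−k+2, 2) ≍ m²/2` for every `k ≥ 3` — dimension six already beats
every `2 × 2` construction (`ν_pack ≍ m²/k²`, books `m−k+1`) and is `k`-independent; with `…AffinePencilCount.lean`
(`C(m,k) ≤ R + c_H`) this is what any upper bound on the exclusion number (Q_psd) has to leave room for, and summing blocks over a
covering design excludes ALL `k`-sets with a pencil of size `6·Cov(m; k−2 ⊂ k)` (memo §2.3 (iv)). [new]
-/

set_option linter.dupNamespace false

namespace Summit.PneNP.PneNP.Theorems

open Finset Real Matrix Literature.Computability.Complexity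
open Summit.PneNP.PneNP.Cruxes.ConvexGateBlind.StrictRankConicCover (Edge cdist)

noncomputable section

namespace SixPencil

variable {m : ℕ}

/-! ## The pencil -/

/-- The base matrix `H₀ = arrow(a₀; 0)`. [new] -/
def H0 (S : Finset (Fin m)) (k : ℕ) : Matrix (Fin 6) (Fin 6) ℝ := arrow (a0 S k) 0

/-- The edge matrices `H_e = arrow(−α_e; −β_e)` (subtracted when `e` is present). [new] -/
def HE (S : Finset (Fin m)) (k : ℕ) (e : Edge m) : Matrix (Fin 6) (Fin 6) ℝ := arrow (-alphaP S k e) (-betaP S k e)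

/-- **The pencil at a graph is the arrow matrix of its SOC data.** [new] -/
theorem pencil_eq (S : Finset (Fin m)) (k : ℕ) (u : Edge m → Bool) :
    (H0 S k - ∑ e, if u e = true then HE S k e else 0) = arrow (abud S k u) (bvec S k u) := by
  classical
  simp only [H0, HE]
  rw [arrow_pencil_apply]
  have h1 : (∑ e, if u e = true then -alphaP S k e else 0) = -∑ e, if u e = true then alphaP S k e else 0 := by
    rw [← Finset.sum_neg_distrib]
    refine Finset.sum_congr rfl fun e _ => ?_
    split_ifs <;> simp
  have h2 : (∑ e, if u e = true then -betaP S k e else 0) = -∑ e, if u e = true then betaP S k e else 0 := by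
    rw [← Finset.sum_neg_distrib]
    refine Finset.sum_congr rfl fun e _ => ?_
    split_ifs <;> simp
  rw [h1, h2, abud, bvec, sub_neg_eq_add, zero_sub, neg_neg]

/-- **Validity**: the pencil is PSD on every `k`-clique-free graph. [new] -/
theorem six_pencil_posSemidef {k : ℕ} (hk : 3 ≤ k) {S : Finset (Fin m)} (hS : S.card = k - 2)
    (u : Edge m → Bool) (hu : cliqueFn m k u = false) :
    (H0 S k - ∑ e, if u e = true then HE S k e else 0).PosSemidef := by
  rw [pencil_eq]
  obtain ⟨h0, h1⟩ := six_pencil_soc_valid hk hS u hu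
  exact arrow_posSemidef h0 h1

/-! ## Exclusion at the bare cliques `S ∪ {a, b}` -/

section Exclusion

variable {k : ℕ} {S : Finset (Fin m)} {a b : Fin m}

/-- At the bare clique `S ∪ {a,b}` the core is complete. [folklore] -/
theorem onCls_two_cliqueVec (S : Finset (Fin m)) (a b : Fin m) :
    onCls S (cliqueVec (insert a (insert b S))) 2 = cores S := by
  ext e
  simp only [onCls, cores, mem_filter, mem_univ, true_and, and_iff_right_iff_imp]
  intro he
  rw [cliqueVec_eq_true_iff_edgeVerts_subset]
  have hsub : edgeVerts e ⊆ S := by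
    have h := card_edgeVerts e
    rw [cls] at he
    have : edgeVerts e ∩ S = edgeVerts e := Finset.eq_of_subset_of_card_le inter_subset_left (by rw [he, h])
    rw [← this]; exact inter_subset_right
  exact hsub.trans ((subset_insert _ _).trans (subset_insert _ _))

/-- At the bare clique `S ∪ {a,b}` the only rim is `{a,b}`. [new] -/
theorem onCls_zero_cliqueVec (ha : a ∉ S) (hb : b ∉ S) (hab : a ≠ b) :
    onCls S (cliqueVec (insert a (insert b S))) 0 = {mkEdge hab} := by
  ext e
  simp only [onCls, mem_filter, mem_univ, true_and, mem_singleton, cliqueVec_eq_true_iff_edgeVerts_subset]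
  constructor
  · rintro ⟨hsub, hcls⟩
    have hdisj : edgeVerts e ∩ S = ∅ := card_eq_zero.1 hcls
    have hsub' : edgeVerts e ⊆ {a, b} := by
      intro v hv
      have hvS : v ∉ S := fun h => by
        have : v ∈ edgeVerts e ∩ S := mem_inter.2 ⟨hv, h⟩
        rw [hdisj] at this; exact absurd this (Finset.notMem_empty v)
      have := hsub hv
      rw [mem_insert, mem_insert] at this
      rcases this with rfl | rfl | h
      · simp
      · simp
      · exact absurd h hvS
    have heq : edgeVerts e = {a, b} :=
      Finset.eq_of_subset_of_card_le hsub' (by rw [card_pair hab, card_edgeVerts])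
    exact eq_mkEdge_of_edgeVerts_eq hab heq
  · rintro rfl
    rw [edgeVerts_mkEdge]
    refine ⟨?_, ?_⟩
    · intro v hv
      rw [mem_insert, mem_singleton] at hv
      rcases hv with rfl | rfl <;> simp
    · rw [cls, edgeVerts_mkEdge]
      refine card_eq_zero.2 ?_
      ext v
      simp only [mem_inter, mem_insert, mem_singleton, Finset.notMem_empty, iff_false, not_and]
      rintro (rfl | rfl) <;> assumption

/-- Every present spoke of the bare clique is seen at height exactly `η_r` by the normal of the rim `r = {a,b}`. [new] -/
theorem spokeVec_dotProduct_nvec_cliqueVec (ha : a ∉ S) (hb : b ∉ S) (hab : a ≠ b) {e : Edge m}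
    (he : e ∈ onCls S (cliqueVec (insert a (insert b S))) 1) :
    spokeVec S e ⬝ᵥ nvec (mkEdge hab) = etaE (mkEdge hab) := by
  simp only [onCls, mem_filter, mem_univ, true_and, cliqueVec_eq_true_iff_edgeVerts_subset] at he
  obtain ⟨hsub, hcls⟩ := he
  obtain ⟨v, hve, hvS, hsv⟩ := spokeVec_eq_Uvec hcls
  rw [hsv]
  refine Uvec_dotProduct_nvec_of_mem ?_
  rw [edgeVerts_mkEdge]
  have := hsub hve
  rw [mem_insert, mem_insert] at this
  rcases this with rfl | rfl | h
  · simp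
  · simp
  · exact absurd h hvS

/-- The `2(k−2)` spokes `{s, x}`, `s ∈ S`, `x ∈ {a,b}` are distinct and present in the bare clique, so the spoke load seen by
the rim normal is at least `2η_r`. [new] -/
theorem two_etaE_le_wvec_dotProduct_nvec (hk : 3 ≤ k) (hS : S.card = k - 2) (ha : a ∉ S) (hb : b ∉ S) (hab : a ≠ b) :
    2 * etaE (mkEdge hab) ≤ wvec S k (cliqueVec (insert a (insert b S))) ⬝ᵥ nvec (mkEdge hab) := by
  classical
  set u := cliqueVec (insert a (insert b S)) with hu
  set r := mkEdge hab with hr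
  have hk3 : (3 : ℝ) ≤ k := by exact_mod_cast hk
  have hk2 : (0 : ℝ) < (k : ℝ) - 2 := by linarith
  have hη := etaE_pos r
  -- the family of spokes
  set P : Finset (Fin m × Fin m) := S ×ˢ ({a, b} : Finset (Fin m)) with hP
  have hne : ∀ p ∈ P, p.1 ≠ p.2 := by
    intro p hp
    simp only [hP, mem_product, mem_insert, mem_singleton] at hp
    rintro heq
    rcases hp.2 with h | h
    · exact ha (h ▸ heq ▸ hp.1)
    · exact hb (h ▸ heq ▸ hp.1)
  set f : {p // p ∈ P} → Edge m := fun p => mkEdge (hne p.1 p.2) with hf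
  set T : Finset (Edge m) := P.attach.image f with hT
  have hfinj : Function.Injective f := by
    rintro ⟨⟨s, x⟩, hp⟩ ⟨⟨s', x'⟩, hp'⟩ h
    have hv := congrArg edgeVerts h
    simp only [hf, edgeVerts_mkEdge] at hv
    simp only [hP, mem_product, mem_insert, mem_singleton] at hp hp'
    have hxS : x ∉ S := by rcases hp.2 with rfl | rfl <;> assumption
    have hx'S : x' ∉ S := by rcases hp'.2 with rfl | rfl <;> assumption
    -- `s ∈ {s', x'}` and `s ∈ S` force `s = s'`, then `x = x'`
    have hs : s = s' := by
      have : s ∈ ({s', x'} : Finset (Fin m)) := by rw [← hv]; simp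
      rw [mem_insert, mem_singleton] at this
      rcases this with h | h
      · exact h
      · exact absurd (h ▸ hp.1) hx'S
    subst hs
    have hx : x = x' := by
      have : x ∈ ({s, x'} : Finset (Fin m)) := by rw [← hv]; simp
      rw [mem_insert, mem_singleton] at this
      rcases this with h | h
      · exact absurd (h ▸ hp.1) hxS
      · exact h
    subst hx
    rfl
  have hTcard : (T.card : ℝ) = 2 * ((k : ℝ) - 2) := by
    rw [hT, card_image_of_injective _ hfinj, card_attach, hP, card_product, card_pair hab, hS]
    rw [Nat.cast_mul, Nat.cast_sub (by omega)]
    push_cast; ring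
  have hTsub : T ⊆ onCls S u 1 := by
    intro e he
    rw [hT, mem_image] at he
    obtain ⟨⟨⟨s, x⟩, hp⟩, -, rfl⟩ := he
    simp only [hP, mem_product, mem_insert, mem_singleton] at hp
    have hxS : x ∉ S := by rcases hp.2 with rfl | rfl <;> assumption
    simp only [onCls, mem_filter, mem_univ, true_and, hu, cliqueVec_eq_true_iff_edgeVerts_subset, hf, edgeVerts_mkEdge]
    refine ⟨?_, ?_⟩
    · intro v hv
      rw [mem_insert, mem_singleton] at hv
      rcases hv with rfl | rfl
      · exact mem_insert_of_mem (mem_insert_of_mem hp.1)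
      · rcases hp.2 with rfl | rfl <;> simp
    · rw [cls, edgeVerts_mkEdge]
      have : ({s, x} : Finset (Fin m)) ∩ S = {s} := by
        ext v
        simp only [mem_inter, mem_insert, mem_singleton]
        constructor
        · rintro ⟨rfl | rfl, hv⟩
          · rfl
          · exact absurd hv hxS
        · rintro rfl; exact ⟨Or.inl rfl, hp.1⟩
      rw [this, card_singleton]
  -- compare the sums
  rw [wvec, sum_dotProduct]
  have hterm : ∀ e ∈ onCls S u 1, ((1 / ((k : ℝ) - 2)) • spokeVec S e) ⬝ᵥ nvec r = etaE r / ((k : ℝ) - 2) := by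
    intro e he
    rw [smul_dotProduct, smul_eq_mul, spokeVec_dotProduct_nvec_cliqueVec ha hb hab he]; ring
  have hle : ∑ e ∈ T, ((1 / ((k : ℝ) - 2)) • spokeVec S e) ⬝ᵥ nvec r ≤
      ∑ e ∈ onCls S u 1, ((1 / ((k : ℝ) - 2)) • spokeVec S e) ⬝ᵥ nvec r :=
    Finset.sum_le_sum_of_subset_of_nonneg hTsub fun e he _ => by
      rw [hterm e he]; exact div_nonneg hη.le hk2.le
  refine le_trans ?_ hle
  rw [Finset.sum_congr rfl fun e he => hterm e (hTsub he), sum_const, nsmul_eq_mul, hTcard]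
  field_simp
  exact le_refl _

/-- `κ < 2`. [folklore] -/
theorem kap_lt_two (hk : 3 ≤ k) : kap k < 2 := by
  have : (3 : ℝ) ≤ k := by exact_mod_cast hk
  have h : 0 < 1 / (2 * ((k : ℝ) - 2)) := div_pos one_pos (by linarith)
  rw [kap]; linarith

/-- **Exclusion**: at the bare clique `S ∪ {a,b}` the SOC data are outside the Lorentz cone. [new] -/
theorem six_pencil_soc_excludes (hk : 3 ≤ k) (hS : S.card = k - 2) (ha : a ∉ S) (hb : b ∉ S) (hab : a ≠ b) :
    0 ≤ abud S k (cliqueVec (insert a (insert b S))) ∧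
      abud S k (cliqueVec (insert a (insert b S))) ^ 2 < ∑ i, bvec S k (cliqueVec (insert a (insert b S))) i ^ 2 := by
  set u := cliqueVec (insert a (insert b S)) with hu
  set r := mkEdge hab with hr
  obtain ⟨hL1, -, -⟩ := Lbig_bounds S hk
  obtain ⟨hκ1, -⟩ := kap_bounds hk
  have hκ2 := kap_lt_two hk
  have hη := etaE_pos r
  have haval : abud S k u = Lbig S k + kap k * etaE r := by
    rw [abud_eq, onCls_two_cliqueVec, onCls_zero_cliqueVec ha hb hab, card_singleton, sum_singleton, cc]
    push_cast; ring
  have hbval : bvec S k u = wvec S k u + Lbig S k • nvec r := by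
    rw [bvec_eq, nsum, onCls_zero_cliqueVec ha hb hab, sum_singleton]
  have ha0 : 0 ≤ abud S k u := by rw [haval]; nlinarith
  refine ⟨ha0, sq_lt_sum_sq_of_lt_dotProduct_unit (nvec_unit r) ha0 ?_⟩
  rw [hbval, add_dotProduct, smul_dotProduct, nvec_unit, smul_eq_mul, mul_one, haval]
  have hw := two_etaE_le_wvec_dotProduct_nvec hk hS ha hb hab
  nlinarith

/-- **Exclusion**: the pencil is not PSD at the bare clique `S ∪ {a,b}`. [new] -/
theorem six_pencil_excludes (hk : 3 ≤ k) (hS : S.card = k - 2) (ha : a ∉ S) (hb : b ∉ S) (hab : a ≠ b) :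
    ¬ (H0 S k - ∑ e, if cliqueVec (insert a (insert b S)) e = true then HE S k e else 0).PosSemidef := by
  rw [pencil_eq]
  obtain ⟨h0, h1⟩ := six_pencil_soc_excludes hk hS ha hb hab
  exact arrow_not_posSemidef_of_sq_lt h0 h1

/-- A `k`-superset of the `(k−2)`-set `S` is `S ∪ {a,b}`. [folklore] -/
theorem eq_insert_insert_of_superset (hk : 3 ≤ k) (hS : S.card = k - 2) {Q : Finset (Fin m)} (hQ : Q.card = k)
    (hSQ : S ⊆ Q) : ∃ a b : Fin m, a ∉ S ∧ b ∉ S ∧ a ≠ b ∧ Q = insert a (insert b S) := by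
  have hcard : (Q \ S).card = 2 := by rw [card_sdiff_of_subset hSQ, hQ, hS]; omega
  obtain ⟨a, b, hab, hQS⟩ := card_eq_two.1 hcard
  have ha : a ∈ Q \ S := by rw [hQS]; simp
  have hb : b ∈ Q \ S := by rw [hQS]; simp
  refine ⟨a, b, (mem_sdiff.1 ha).2, (mem_sdiff.1 hb).2, hab, ?_⟩
  rw [← sdiff_union_of_subset hSQ, hQS]
  ext v; simp

end Exclusion

/-! ## The count -/

open Classical in
/-- **`c(6; m, k) ≥ C(m − (k−2), 2)`**: the `2`-subsets `P` of the complement of `S` give distinct excluded `k`-sets `P ∪ S`. [new] -/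
theorem choose_le_card_excluded {k : ℕ} (hk : 3 ≤ k) {S : Finset (Fin m)} (hS : S.card = k - 2) :
    (m - (k - 2)).choose 2 ≤ (((Finset.univ : Finset (Fin m)).powersetCard k).filter fun Q =>
      ¬ (H0 S k - ∑ e, if cliqueVec Q e = true then HE S k e else 0).PosSemidef).card := by
  classical
  have hsrc : ((Finset.univ \ S).powersetCard 2).card = (m - (k - 2)).choose 2 := by
    rw [card_powersetCard, card_sdiff_of_subset (subset_univ S), card_univ, Fintype.card_fin, hS]
  rw [← hsrc]
  refine Finset.card_le_card_of_injOn (fun P => P ∪ S) (fun P hP => ?_) ?_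
  · rw [Finset.mem_coe, mem_powersetCard] at hP
    obtain ⟨hPsub, hPcard⟩ := hP
    obtain ⟨a, b, hab, rfl⟩ := card_eq_two.1 hPcard
    have ha : a ∉ S := (mem_sdiff.1 (hPsub (by simp))).2
    have hb : b ∉ S := (mem_sdiff.1 (hPsub (by simp))).2
    have hQ : ({a, b} : Finset (Fin m)) ∪ S = insert a (insert b S) := by ext v; simp
    show {a, b} ∪ S ∈ (((Finset.univ : Finset (Fin m)).powersetCard k).filter fun Q =>
      ¬ (H0 S k - ∑ e, if cliqueVec Q e = true then HE S k e else 0).PosSemidef : Set (Finset (Fin m)))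
    rw [Finset.mem_coe, mem_filter, mem_powersetCard, hQ]
    refine ⟨⟨subset_univ _, ?_⟩, six_pencil_excludes hk hS ha hb hab⟩
    rw [card_insert_of_notMem (by simp [hab, ha]), card_insert_of_notMem hb, hS]; omega
  · intro P hP P' hP' h
    have hPd : Disjoint P S := by
      rw [Finset.mem_coe, mem_powersetCard] at hP
      exact Finset.disjoint_of_subset_left hP.1 sdiff_disjoint
    have hP'd : Disjoint P' S := by
      rw [Finset.mem_coe, mem_powersetCard] at hP'
      exact Finset.disjoint_of_subset_left hP'.1 sdiff_disjoint
    have h1 : (P ∪ S) \ S = P := by rw [union_sdiff_right, Finset.sdiff_eq_self_iff_disjoint.2 hPd]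
    have h2 : (P' ∪ S) \ S = P' := by rw [union_sdiff_right, Finset.sdiff_eq_self_iff_disjoint.2 hP'd]
    have := congrArg (fun X : Finset (Fin m) => X \ S) h
    simpa [h1, h2] using this

end SixPencil

open Classical in
/-- **PROPOSITION L — one valid `6 × 6` pencil excludes every `k`-set through a `(k−2)`-set** (registered form). For
`3 ≤ k` and every `S ⊆ [m]` with `#S = k − 2` there is an affine `6 × 6` pencil `H(x) = H₀ − Σ_e x_e H_e` that is positive
semidefinite on every `k`-clique-free graph, not positive semidefinite at the bare clique of every `k`-set `Q ⊇ S`, and hence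
has exclusion number at least `C(m − (k−2), 2)`: `c(6; m, k) ≥ C(m−k+2, 2)`. [new] -/
theorem six_pencil_exclusion_number : ∀ {m k : ℕ}, 3 ≤ k → ∀ (S : Finset (Fin m)), S.card = k - 2 → ∃ (H₀ : Matrix (Fin 6) (Fin 6) ℝ) (He : Edge m → Matrix (Fin 6) (Fin 6) ℝ), (∀ u : Edge m → Bool, cliqueFn m k u = false → (H₀ - ∑ e, if u e = true then He e else 0).PosSemidef) ∧ (∀ Q : Finset (Fin m), Q.card = k → S ⊆ Q → ¬ (H₀ - ∑ e, if cliqueVec Q e = true then He e else 0).PosSemidef) ∧ (m - (k - 2)).choose 2 ≤ (((Finset.univ : Finset (Fin m)).powersetCard k).filter fun Q => ¬ (H₀ - ∑ e, if cliqueVec Q e = true then He e else 0).PosSemidef).card := by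
  intro m k hk S hS
  refine ⟨SixPencil.H0 S k, SixPencil.HE S k, fun u hu => SixPencil.six_pencil_posSemidef hk hS u hu, fun Q hQ hSQ => ?_,
    SixPencil.choose_le_card_excluded hk hS⟩
  obtain ⟨a, b, ha, hb, hab, rfl⟩ := SixPencil.eq_insert_insert_of_superset hk hS hQ hSQ
  exact SixPencil.six_pencil_excludes hk hS ha hb hab

end

end Summit.PneNP.PneNP.Theorems
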